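/-
Copyright (c) 2026. All rights reserved.
Released under Apache 2.0 license as described in the file LICENSE.
Authors: abc-iut cell, prover seat abc-iut-w5-d241 (wave 5, gen 9).
-/
import Summits.ABC.IUTFork.Cor312PilotIdelesPrArchThreshold
import Summits.ABC.IUTFork.LDHPerPrimeReadingWitness
import HarnessLib

/-!
# The fourth corner: an EXPLICIT small-height pilot datum at which the typed `Statement` holds

Proof-only witness file (no definitions) for `Cor312PilotIdelesPrArchThreshold.lean` (abc-iut-w5-d241: at the
print-normalised setting with abc-iut-w5-d163's honest archimedean container and pilot regions from realising
ideles, `GlobalVolumeTransport ↔ deĝ̲(𝔮) ≤ c(l)·log π`, and small height + `2l ∣ ord_v(q_v)` ⇒ ∃ ideles with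
`ThetaFinite ∧ BridgeHyps ∧ AbsLogQPos ∧ GlobalVolumeTransport ∧ Statement`).  Here the small-height family is
INHABITED by abc-iut-w5-d157's synthetic pilot datum `PilotData.deepAt F₀ p l N` (`j_E := p^{−2lN}`, `S := V(F₀)_p`;
`ord_v(q_v) = 2lN·e_v`, `LDHPerPrimeReadingWitness.lean`) over ANY number field `F₀`:

* `ndeg_qDivisor_deepAt` — `deĝ̲(𝔮) = 2lN·log p` for `deepAt F₀ p l N` (fundamental identity `Σ_{v|p} e_v f_v = [F₀:ℚ]`,
  abc-iut-S2's `sum_localDegree`);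
* `deepAt_two_mul_l_dvd_ordq` — `2l ∣ ord_v(q_v)` on `S` (realising ideles exist, [IUTchI] Ex. 3.2 (iv));
* `ndeg_qDivisor_deepAt_two_five_le` — at `(p, l, N) = (2, 5, 1)`: `deĝ̲(𝔮) = 10·log 2 ≤ c(5)·log π = (50/3)·log π`;
* **`exists_ideles_statement_settingPrVolArchSharp_deepAt_two_five`** — for every number field `F₀` (all of whose
  infinite places are complex, the standing hypothesis `hc` of the fourth-corner container) and every choice of
  the free context binders, there are realising Θ- and `q`-ideles at which, at the fourth corner over the pilot datum
  `deepAt F₀ 2 5 1` (`j_E = 2^{−10}`, `S = V(F₀)_2`, `l = 5`),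
  `ThetaFinite ∧ BridgeHyps ∧ AbsLogQPos ∧ GlobalVolumeTransport ∧ Statement` hold simultaneously.

So the typed Cor. 3.12 `Statement` is TRUE at an inhabited, honest-`∞`, print-normalised instantiation — a census
datum on the generosity of the archimedean MODEL container at small Tate height (`deĝ̲(𝔮) = 10·log 2 ≈ 6.93`), not a
statement about print.  HONEST FRAMING: synthetic pilot datum (chosen for its valuations, not claimed to come from a
specific elliptic curve or initial Θ-datum); no side taken on [IUTchIII] Cor. 3.12; nothing here asserts abc.
typed ≠ proved; instantiated ≠ endorsed.
-/

noncomputable section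

open Set Function NumberField IsDedekindDomain Finset
open scoped Pointwise

namespace Summit.ABC

namespace IUTFork

namespace Thm311

namespace Real

open Cor312 Cor312Vol Literature.IUT.LogThetaLattice Literature.IUT.LogVolume

section DeepAtDegree

variable (F₀ : Type) [Field F₀] [NumberField F₀]
variable (p : ℕ) [hp : Fact p.Prime] (l : ℕ) (hl : l.Prime) (h5 : 5 ≤ l) (N : ℕ) (hN : 0 < N)

/-- **`deĝ̲(𝔮) = 2lN·log p`** for the synthetic pilot datum `deepAt F₀ p l N` (`ord_v(q_v) = 2lN·e_v` at every `v | p`,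
`ln|κ(v)| = f_v·ln p`, and the fundamental identity `Σ_{v|p} e_v f_v = [F₀:ℚ]`). [cite: DupuyHilado2025, §3.3, §3.6] -/
theorem ndeg_qDivisor_deepAt :
    FinDivisor.ndeg F₀ (PilotData.deepAt F₀ p l hl h5 N hN).qDivisor = 2 * l * N * Real.log p := by
  have hd : (0 : ℝ) < Module.finrank ℚ F₀ := FinDivisor.finrank_pos
  rw [FinDivisor.ndeg_apply, PilotData.deg_qDivisor]
  have hS : (PilotData.deepAt F₀ p l hl h5 N hN).S = placesOver F₀ p := rfl
  rw [hS]
  have hterm : ∀ v ∈ placesOver F₀ p,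
      ((PilotData.deepAt F₀ p l hl h5 N hN).ordq v : ℝ) * logNorm F₀ v =
        2 * l * N * Real.log p * (localDegree F₀ v : ℝ) := by
    intro v hv
    rw [PilotData.deepAt_ordq p l hl h5 N hN v hv, logNorm_eq, (mem_placesOver_iff_residueChar v).mp hv,
      localDegree]
    push_cast
    ring
  rw [Finset.sum_congr rfl hterm, ← Finset.mul_sum]
  have hsum : ∑ v ∈ placesOver F₀ p, (localDegree F₀ v : ℝ) = Module.finrank ℚ F₀ := by
    exact_mod_cast sum_localDegree F₀ p
  rw [hsum]
  field_simp

/-- `2l ∣ ord_v(q_v)` on `S = V(F₀)_p` for `deepAt F₀ p l N` (`ord_v(q_v) = 2lN·e_v`) — the displayed side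
condition of [IUTchI] Ex. 3.2 (iv) under which realising ideles exist. [cite: DupuyHilado2025, §3.3, §3.4];
[cite: Mochizuki2012, IUTchI Ex. 3.2 (iv)] -/
theorem deepAt_two_mul_l_dvd_ordq :
    ∀ v ∈ (PilotData.deepAt F₀ p l hl h5 N hN).S,
      (2 * (PilotData.deepAt F₀ p l hl h5 N hN).l : ℤ) ∣ (PilotData.deepAt F₀ p l hl h5 N hN).ordq v := by
  intro v hv
  show (2 * (l : ℤ)) ∣ (PilotData.deepAt F₀ p l hl h5 N hN).ordq v
  rw [PilotData.deepAt_ordq p l hl h5 N hN v hv]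
  exact ⟨N * ramIdx F₀ v, by ring⟩

end DeepAtDegree

section TwoFive

variable (F₀ : Type) [Field F₀] [NumberField F₀]

/-- **`deĝ̲(𝔮) = 10·log 2 ≤ c(5)·log π = (50/3)·log π`** for the pilot datum `deepAt F₀ 2 5 1` (`j_E = 2^{−10}`,
`S = V(F₀)_2`, `l = 5`): `10·log 2 ≤ 10·log π ≤ (50/3)·log π`. [cite: DupuyHilado2025, §3.3] -/
theorem ndeg_qDivisor_deepAt_two_five_le :
    FinDivisor.ndeg F₀ (PilotData.deepAt F₀ 2 5 Nat.prime_five le_rfl 1 Nat.one_pos).qDivisor ≤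
      6 * (PilotData.deepAt F₀ 2 5 Nat.prime_five le_rfl 1 Nat.one_pos).l * ((PilotData.deepAt F₀ 2 5 Nat.prime_five le_rfl 1 Nat.one_pos).l + 5) /
        (((PilotData.deepAt F₀ 2 5 Nat.prime_five le_rfl 1 Nat.one_pos).l + 4) * ((PilotData.deepAt F₀ 2 5 Nat.prime_five le_rfl 1 Nat.one_pos).l - 3)) * Real.log Real.pi := by
  rw [ndeg_qDivisor_deepAt]
  have hl5 : ((PilotData.deepAt F₀ 2 5 Nat.prime_five le_rfl 1 Nat.one_pos).l : ℝ) = 5 := by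
    show ((5 : ℕ) : ℝ) = 5
    norm_num
  rw [hl5]
  have hlog2 : Real.log ((2 : ℕ) : ℝ) ≤ Real.log Real.pi := by
    push_cast
    exact Real.log_le_log (by norm_num) (by linarith [Real.pi_gt_three])
  have hlogpi : 0 ≤ Real.log Real.pi := Real.log_nonneg (by linarith [Real.two_le_pi])
  push_cast at hlog2 ⊢
  nlinarith

/-- **THE TYPED `Statement` HOLDS AT AN INHABITED FOURTH-CORNER INSTANTIATION.** For every number field `F₀` with all
infinite places complex, analytic `p`-adic logarithms, and every choice of the free context binders, over the pilot
datum `X₀ := deepAt F₀ 2 5 1` (`j_E = 2^{−10}`, `S = V(F₀)_2`, `l = 5`; `deĝ̲(𝔮) = 10·log 2`) there are realising Θ- and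
`q`-ideles at which `ThetaFinite ∧ BridgeHyps ∧ AbsLogQPos ∧ GlobalVolumeTransport ∧ Statement` hold at
`settingPrVolArchSharp`. [claim: Mochizuki2012, status: disputed] for the quoted setting;
[cite: DupuyHilado2025, §3.3, §3.4, Thm. 3.10.1]; [cite: Mochizuki2012, IUTchI Ex. 3.2 (iv)] -/
theorem exists_ideles_statement_settingPrVolArchSharp_deepAt_two_five
    {logv : PadicLogs F₀} (hlog : LogvAnalytic logv) (hc : ∀ w : InfinitePlace F₀, w.IsComplex)
    (M : Type) [Field M] [NumberField M]
    (archPk : ∀ (j : (thetaIndex (PilotData.deepAt F₀ 2 5 Nat.prime_five le_rfl 1 Nat.one_pos)).Label) (vQ : (thetaIndex (PilotData.deepAt F₀ 2 5 Nat.prime_five le_rfl 1 Nat.one_pos)).VQ),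
      Set ((logShellsDH (PilotData.deepAt F₀ 2 5 Nat.prime_five le_rfl 1 Nat.one_pos) logv).Packet j vQ))
    (archSub : ∀ (j : (thetaIndex (PilotData.deepAt F₀ 2 5 Nat.prime_five le_rfl 1 Nat.one_pos)).Label) (v : (thetaIndex (PilotData.deepAt F₀ 2 5 Nat.prime_five le_rfl 1 Nat.one_pos)).V),
      Set ((logShellsDH (PilotData.deepAt F₀ 2 5 Nat.prime_five le_rfl 1 Nat.one_pos) logv).Packet j ((thetaIndex (PilotData.deepAt F₀ 2 5 Nat.prime_five le_rfl 1 Nat.one_pos)).over v)))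
    (Ψ : ℤ → ∀ v : (thetaIndex (PilotData.deepAt F₀ 2 5 Nat.prime_five le_rfl 1 Nat.one_pos)).V, v ∈ (thetaIndex (PilotData.deepAt F₀ 2 5 Nat.prime_five le_rfl 1 Nat.one_pos)).Vbad →
      Set ((logShellsDH (PilotData.deepAt F₀ 2 5 Nat.prime_five le_rfl 1 Nat.one_pos) logv).StarPacket v))
    (act : ℤ → ∀ v : (thetaIndex (PilotData.deepAt F₀ 2 5 Nat.prime_five le_rfl 1 Nat.one_pos)).V, v ∈ (thetaIndex (PilotData.deepAt F₀ 2 5 Nat.prime_five le_rfl 1 Nat.one_pos)).Vbad →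
      (logShellsDH (PilotData.deepAt F₀ 2 5 Nat.prime_five le_rfl 1 Nat.one_pos) logv).StarPacket v → Module.End ℚ ((logShellsDH (PilotData.deepAt F₀ 2 5 Nat.prime_five le_rfl 1 Nat.one_pos) logv).StarPacket v))
    (Mmod : ℤ → ∀ j : (thetaIndex (PilotData.deepAt F₀ 2 5 Nat.prime_five le_rfl 1 Nat.one_pos)).LabelStar, Set ((logShellsDH (PilotData.deepAt F₀ 2 5 Nat.prime_five le_rfl 1 Nat.one_pos) logv).GlobalPacket j.1))
    (region : ℤ → ∀ j : (thetaIndex (PilotData.deepAt F₀ 2 5 Nat.prime_five le_rfl 1 Nat.one_pos)).LabelStar, FinDivisor M → ∀ vQ : (thetaIndex (PilotData.deepAt F₀ 2 5 Nat.prime_five le_rfl 1 Nat.one_pos)).VQ,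
      Set ((logShellsDH (PilotData.deepAt F₀ 2 5 Nat.prime_five le_rfl 1 Nat.one_pos) logv).Packet j.1 vQ))
    (n : ℤ) {HT : Type} {LogLink : HT → HT → Type} {IsFull : ∀ {s t : HT}, LogLink s t → Prop}
    (lat : LGPGaussianLogThetaLattice LogLink IsFull)
    {Frd : Type} {IsoF : Frd → Frd → Type} {Ob : Frd → Type} {realify : Frd → Frd} {Strip : Type}
    {IsoS : Strip → Strip → Type} {Mv : ∀ v : (thetaIndex (PilotData.deepAt F₀ 2 5 Nat.prime_five le_rfl 1 Nat.one_pos)).V, v ∈ (thetaIndex (PilotData.deepAt F₀ 2 5 Nat.prime_five le_rfl 1 Nat.one_pos)).Vbad → Type}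
    [∀ v h, Monoid (Mv v h)]
    (sig : GlobalLGPFrobenioidSignature (thetaIndex (PilotData.deepAt F₀ 2 5 Nat.prime_five le_rfl 1 Nat.one_pos)).lstar (thetaIndex (PilotData.deepAt F₀ 2 5 Nat.prime_five le_rfl 1 Nat.one_pos)).V (· ∈ (thetaIndex (PilotData.deepAt F₀ 2 5 Nat.prime_five le_rfl 1 Nat.one_pos)).Vbad)
      Frd IsoF Ob realify Strip IsoS Mv)
    (split : SplittingMonoids Mv) {ObΔ : Type} {N : ∀ v : (thetaIndex (PilotData.deepAt F₀ 2 5 Nat.prime_five le_rfl 1 Nat.one_pos)).V, v ∈ (thetaIndex (PilotData.deepAt F₀ 2 5 Nat.prime_five le_rfl 1 Nat.one_pos)).Vbad → Type}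
    [∀ v h, Monoid (N v h)] (qData : QPilotData ObΔ N) :
    ∃ (t' : ∀ (pp : Nat.Primes) (_ : Fin (PilotData.deepAt F₀ 2 5 Nat.prime_five le_rfl 1 Nat.one_pos).lstar) (x : (thetaIndex (PilotData.deepAt F₀ 2 5 Nat.prime_five le_rfl 1 Nat.one_pos)).Fibre (.inr pp)),
          haveI : Fact (pp : ℕ).Prime := ⟨pp.2⟩; kOf (PilotData.deepAt F₀ 2 5 Nat.prime_five le_rfl 1 Nat.one_pos) pp.1 x)
      (tq' : ∀ (pp : Nat.Primes) (x : (thetaIndex (PilotData.deepAt F₀ 2 5 Nat.prime_five le_rfl 1 Nat.one_pos)).Fibre (.inr pp)),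
          haveI : Fact (pp : ℕ).Prime := ⟨pp.2⟩; kOf (PilotData.deepAt F₀ 2 5 Nat.prime_five le_rfl 1 Nat.one_pos) pp.1 x)
      (_ : ∀ pp i x, t' pp i x ≠ 0)
      (_ : ∀ (pp : Nat.Primes) (i : Fin (PilotData.deepAt F₀ 2 5 Nat.prime_five le_rfl 1 Nat.one_pos).lstar) (x : (thetaIndex (PilotData.deepAt F₀ 2 5 Nat.prime_five le_rfl 1 Nat.one_pos)).Fibre (.inr pp)),
          haveI : Fact (pp : ℕ).Prime := ⟨pp.2⟩
          Real.log ‖t' pp i x‖ = -((PilotData.deepAt F₀ 2 5 Nat.prime_five le_rfl 1 Nat.one_pos).thetaPilot i (placeOf (PilotData.deepAt F₀ 2 5 Nat.prime_five le_rfl 1 Nat.one_pos) pp.1 x)) * logNorm F₀ (placeOf (PilotData.deepAt F₀ 2 5 Nat.prime_five le_rfl 1 Nat.one_pos) pp.1 x) /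
            localDegree F₀ (placeOf (PilotData.deepAt F₀ 2 5 Nat.prime_five le_rfl 1 Nat.one_pos) pp.1 x))
      (htq0' : ∀ pp x, tq' pp x ≠ 0)
      (htq1' : ∀ (pp : Nat.Primes) (x : (thetaIndex (PilotData.deepAt F₀ 2 5 Nat.prime_five le_rfl 1 Nat.one_pos)).Fibre (.inr pp)),
          haveI : Fact (pp : ℕ).Prime := ⟨pp.2⟩; placeOf (PilotData.deepAt F₀ 2 5 Nat.prime_five le_rfl 1 Nat.one_pos) pp.1 x ∉ (PilotData.deepAt F₀ 2 5 Nat.prime_five le_rfl 1 Nat.one_pos).S → ‖tq' pp x‖ = 1)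
      (_ : ∀ (pp : Nat.Primes) (x : (thetaIndex (PilotData.deepAt F₀ 2 5 Nat.prime_five le_rfl 1 Nat.one_pos)).Fibre (.inr pp)),
          haveI : Fact (pp : ℕ).Prime := ⟨pp.2⟩
          Real.log ‖tq' pp x‖ = -((PilotData.deepAt F₀ 2 5 Nat.prime_five le_rfl 1 Nat.one_pos).qPilot (placeOf (PilotData.deepAt F₀ 2 5 Nat.prime_five le_rfl 1 Nat.one_pos) pp.1 x)) * logNorm F₀ (placeOf (PilotData.deepAt F₀ 2 5 Nat.prime_five le_rfl 1 Nat.one_pos) pp.1 x) /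
            localDegree F₀ (placeOf (PilotData.deepAt F₀ 2 5 Nat.prime_five le_rfl 1 Nat.one_pos) pp.1 x)),
      (settingPrVolArchSharp (PilotData.deepAt F₀ 2 5 Nat.prime_five le_rfl 1 Nat.one_pos) hlog hc M archPk archSub Ψ act Mmod region n lat sig split qData t' tq' htq0' htq1').ThetaFinite ∧
      BridgeHyps (settingPrVolArchSharp (PilotData.deepAt F₀ 2 5 Nat.prime_five le_rfl 1 Nat.one_pos) hlog hc M archPk archSub Ψ act Mmod region n lat sig split qData t' tq' htq0' htq1') ∧
      (settingPrVolArchSharp (PilotData.deepAt F₀ 2 5 Nat.prime_five le_rfl 1 Nat.one_pos) hlog hc M archPk archSub Ψ act Mmod region n lat sig split qData t' tq' htq0' htq1').AbsLogQPos ∧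
      GlobalVolumeTransport
        (settingPrVolArchSharp (PilotData.deepAt F₀ 2 5 Nat.prime_five le_rfl 1 Nat.one_pos) hlog hc M archPk archSub Ψ act Mmod region n lat sig split qData t' tq' htq0' htq1') ∧
      (settingPrVolArchSharp (PilotData.deepAt F₀ 2 5 Nat.prime_five le_rfl 1 Nat.one_pos) hlog hc M archPk archSub Ψ act Mmod region n lat sig split qData t' tq' htq0' htq1').Statement :=
  exists_ideles_statement_settingPrVolArchSharp (PilotData.deepAt F₀ 2 5 Nat.prime_five le_rfl 1 Nat.one_pos) hlog hc M archPk archSub Ψ act Mmod region n lat sig split qData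
    (deepAt_two_mul_l_dvd_ordq F₀ 2 5 Nat.prime_five le_rfl 1 Nat.one_pos) (ndeg_qDivisor_deepAt_two_five_le F₀)

end TwoFive

end Real

end Thm311

end IUTFork

end Summit.ABC

end
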